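import Summits.QuantumFields.GaugeBoot.Certificates.SparseReducedWindow
import Summits.QuantumFields.GaugeBoot.Certificates.KZL2rpD4b23o10UpDA
import Summits.QuantumFields.GaugeBoot.Certificates.KZL2rpD4b23o10UpDB
import Summits.QuantumFields.GaugeBoot.Certificates.KZL2rpD4b23o10UpDC
import HarnessLib

/-!
# Kernel replay of the certsdp certificate `kzL2_D4_b23o10_max_rp_G2` — part G: factor-row assembly and objective (gb_lean_emit_win 0.10)

HONEST FRAMING (cell `pub-gaugeboot`): certified bounds on lattice expectations at stated coupling,
gauge group, dimension and torus size; NOT a mass gap, NOT a continuum limit, NOT a string tension;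
NOT Yang–Mills-summit-bearing (barriers `FixedCouplingUltralocality`, `PerturbativeInvisibility`).

Certificate sha256 `4f867b102ddeb84d6b8d5b5ae5fd4df9427ccaa0de0dfd74637e12fbc3884895` (problem `kzL2_D4_b23o10_max_rp_G2`, sha256 `d77a5d7e8d63feddc47744c6df9a5dd23b3f63331b46fbcabbad35e35c864984`): `GB` = all factor rows (data parts
`Certificates/KZL2rpD4b23o10UpD….lean` concatenated), the INTEGER objective row `cZ`, the certified bound `lowerQ`, and the kernel check
`gb_len` (factor rows fit the padded dimension 48). Windows: `Certificates/KZL2rpD4b23o10UpA….lean`; assembly + theorems: `Certificates/KZL2rpD4b23o10Up.lean`.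
Data/plumbing only; nothing is claimed about lattice gauge theory in this file.
-/

namespace Summit.QuantumFields.GaugeBoot.Certificates.KZL2rpD4b23o10Up

noncomputable section

open Summit.QuantumFields.GaugeBoot.Certificates.Sparse

/-- All factor rows (concatenation of the data parts' block lists). -/
def GB : List (List (List ℤ)) := GBa ++ GBb ++ GBc

/-- Objective as a sparse INTEGER row: (-1)·y_1. -/
def cZ : List (ℕ × ℤ) := [(1, Int.negSucc 0)]

/-- The certified lower bound on the objective (exact): `-73940766796134329436086375186497137447295337/108976315889193352379670196744896066355200000` (≈ -0.6785030875086). -/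
def lowerQ : ℚ := -73940766796134329436086375186497137447295337/108976315889193352379670196744896066355200000

set_option maxHeartbeats 0 in
/-- Kernel check: every factor row of every block has length `≤ 48`. -/
theorem gb_len : lenCheckAll KZL2rpD4b23o10Up.GB 48 70 = true := by
  decide +kernel

end

end Summit.QuantumFields.GaugeBoot.Certificates.KZL2rpD4b23o10Up
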